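import Summits.ResolutionOfSingularities.ResolutionOfSingularities.Theorems.PurelyInseparableDim4ComponentHoppingFamily
import Summits.ResolutionOfSingularities.ResolutionOfSingularities.Theorems.PurelyInseparableDim4Rules
import Summits.ResolutionOfSingularities.ResolutionOfSingularities.Theorems.PurelyInseparableDim4MohAlong
import Summits.ResolutionOfSingularities.ResolutionOfSingularities.Theorems.PurelyInseparableDim4CleaningDisjoint
import HarnessLib

/-!
# COMPONENT HOPPING AT `(q,q)` FOR EVERY `q ≥ 2` ‖ K: a uniform lone-component hop 2-cycle over every field
# (cell `res-dim4-pi`, seat res-dim4-p-4 g2; the `∀p` version of the located R_OD-global cycles of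
# `…RODGlobalTwoCycle22` / `…RODGlobalCycles22A–D` / `…RODGlobalCycles33A`)

[OURS · counted 0 · a statement about OUR coordinate-centre frame (`PIDim4.Edge`, `PIDim4.StepRule`,
`PIDim4.TerminatesUnder`, `ComponentThreads.IsComponent`); nothing here proves or refutes resolution of
singularities in dimension `≥ 4` / characteristic `p`, and nothing is claimed about the ∃-forms F4-C(q,q).]

THE FAMILY.  For `q ≥ 2`, over ANY field `K`, put
  `A_q = x₂·x₄^{2q−2} + x₁^{q−1}·x₂·(x₃ + 1)^{2q−2}`,   `B_q = x₂·x₃^{2q−2} + x₁^{q−1}·x₂·(x₄ + 1)^{2q−2}`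
(its `x₃ ↔ x₄` mirror), bookkeeping `r = 0`, `exc = {x₁}`.  Then (§2) `ord_{(x₁,x₂,x₄)} A_q = q` and the
coordinate `q`-fold locus of `A_q` has EXACTLY ONE component, the LINE `V(x₁,x₂,x₄)` (`isComponent_sA_iff`:
a permissible `S′` must contain `x₄` — monomial `x₂x₄^{2q−2}` — and `x₁`, `x₂` — monomial `x₁^{q−1}x₂` —
and `{x₁,x₂,x₄}` minus any letter is not permissible); (§3) blowing up that line and passing to the point
`b = (0, 0, −1, 1)` of the `x₁`-chart — the HOP `x₃ ↦ x₃ − 1` ALONG the centre (so `x₃ + 1 ↦ x₃`) with fibre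
coordinate `x₄ ↦ x₄ + 1` — is an equimultiple reply and `CentreBlowup.step q {x₁,x₂,x₄} x₁ b A_q = B_q`
LITERALLY (chart: the `x₁`-exponents `(0, q−1) ↦ (q−1, 0)`; nothing is a `q`-th power since `x₂` has
exponent `1`; `r`, `exc` return); symmetrically `step q {x₁,x₂,x₃} x₁ (0,0,1,−1) B_q = A_q`.  Hence (§4)
**for every `q ≥ 2` and every field `K`, every LONE-COMPONENT rule** (a coordinate rule that blows up THE
component whenever the coordinate `q`-fold locus has exactly one — R_OD-global with any tie-break,
cardinality-first among components, max-dimensional-component rules, …) **has the infinite `StepRule`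
branch `A B A B …`**, so `¬ TerminatesUnder q R` (`not_terminatesUnder_of_loneComponentRule`): the
component-hopping pathology located at `(2,2)` (eng-w4 g2 S1a-296) and `(3,3)` (LOOP-C/D/E, S2a census) is
uniform in the exponent `q` — the analogue for component-keyed rules of `CoordinateCage.not_terminatesSomeRule_of_prime`.
At `q = 3` the member is eng-w4's located cycle type S2a-2118, S2a-10877 (`ROD33`), and the sister family
`x₂x₄^{2q−2−k}(x₃+1)^k + x₁^{q−1−k}x₂x₄^k(x₃+1)^{2q−2−k}` (`k ≤ q − 2`; `k = 1`, `q = 3` = S2a-463, S2a-1629,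
`ROD33.cyc1`) behaves identically (stdlib check `famcheck.py`, not typed here).  SCOPE is NOT claimed in this
file: for `q ≥ 3` the states pass `LoopC.scopeTreeB` numerically (p = 3, 5, 7), at `q = 2` the member is OUT of
coordinate scope (`x₄² = x₁(x₃+1)²`); the rule-level negative needs no scope clause.  RIDERS (res-dim4-crit-4 g3,
hand check of (i)–(ii) symbolic in `p`, `k`, bus 2026-08-29T01:54Z): the statement lives in the GLOBAL game `Edge`
(replies along the centre allowed) — under the local class `EdgeLoc` (`b = 0` off the centre) it says nothing; and
the hop lands exactly over the one point `x₃ + 1 = 0` of the line where the residual order of `A_q` jumps from `q` to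
`2q − 1` — any rule refined by the residual order or a secondary invariant sees that point before blowing up the line.
The arithmetic of §3 is characteristic-free (no `CharP` hypothesis is used): the frame `(q, q)` is meaningful for
`q = p` prime over fields of characteristic `p`, which is the corollary `…_prime`.
bears_on: LADDER-RESOLUTION:D157-DOOR2 (res-dim4-pi · R_OD-glob / component rules DEAD at every (q,q)).
Supports stmt-ResolutionOfSingularities-16155 (helper).
-/

set_option linter.dupNamespace false -- mandated namespace of this single-conjunct summit

noncomputable section

open MvPolynomial Finset
open scoped BigOperators

namespace Summit.ResolutionOfSingularities.ResolutionOfSingularities.Theorems.PIDim4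

namespace HopAllPrimes

open ComponentThreads
open Literature.AlgebraicGeometry.Resolution
open Literature.AlgebraicGeometry.Resolution.Hauser2010
open Literature.AlgebraicGeometry.Resolution.CentreBlowup

variable {K : Type} [Field K]

/-! ## §3 The two hops -/

/-- B's reply at `A_q`: the point `(0, 0, −1, 1)` of the `x₁`-chart (hop `x₃ ↦ x₃ − 1` along the centre,
fibre coordinate `x₄ = 1`). [folklore] -/
def bA : Fin 4 → K := ![0, 0, -1, 1]

/-- B's reply at `B_q`: the point `(0, 0, 1, −1)` of the `x₁`-chart. [folklore] -/
def bB : Fin 4 → K := ![0, 0, 1, -1]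

/-- the support of `(x_i + 1)^n` consists of powers of `x_i`. [folklore] -/
theorem apply_eq_zero_of_mem_support_X_add_one_pow (i : Fin 4) (n : ℕ) {k : Fin 4 →₀ ℕ}
    (hk : k ∈ ((X i + 1) ^ n : MvPolynomial (Fin 4) K).support) {l : Fin 4} (hl : l ≠ i) : k l = 0 := by
  classical
  have hsum : ((X i + 1) ^ n : MvPolynomial (Fin 4) K) =
      ∑ m ∈ range (n + 1), monomial (Finsupp.single i m) ((n.choose m : ℕ) : K) := by
    rw [add_pow]
    refine Finset.sum_congr rfl fun m _ => ?_
    rw [one_pow, mul_one, X_pow_eq_monomial, ← map_natCast (C : K →+* MvPolynomial (Fin 4) K), mul_comm,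
      C_mul_monomial, mul_one]
  rw [hsum] at hk
  obtain ⟨m, -, -, h⟩ := PointBlowup.exists_of_mem_support_sum_monomial _ _ _ hk
  rw [← h, Finsupp.single_apply, if_neg hl.symm]

/-- **the `x₁`-chart transform of `A_q`**: `x₁^{q−1}x₂x₄^{2q−2} + x₂(x₃+1)^{2q−2}` (`q ≥ 1`). [folklore] -/
theorem chartTransform_hopA {q : ℕ} (hq : 1 ≤ q) : chartTransform q SA 0 (hopA K q) =
    X 0 ^ (q - 1) * X 1 * X 3 ^ (2 * q - 2) + X 1 * (X 2 + 1) ^ (2 * q - 2) := by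
  classical
  have h1 : (X 1 * X 3 ^ (2 * q - 2) : MvPolynomial (Fin 4) K) = monomial (ex 0 1 0 (2 * q - 2)) 1 := by
    rw [monomial_ex, C_1]; ring
  have h2 : (X 0 ^ (q - 1) * X 1 : MvPolynomial (Fin 4) K) = monomial (ex (q - 1) 1 0 0) 1 := by
    rw [monomial_ex, C_1]; ring
  have hc1 : chartExponent q SA 0 (ex 0 1 0 (2 * q - 2)) = ex (q - 1) 1 0 (2 * q - 2) := by
    rw [chartExponent_eq_iff, degIn_SA]
    refine ⟨by simp; omega, fun i hi => ?_⟩; fin_cases i <;> simp_all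
  have hc2 : chartExponent q SA 0 (ex (q - 1) 1 0 0) = ex 0 1 0 0 := by
    rw [chartExponent_eq_iff, degIn_SA]
    refine ⟨by simp; omega, fun i hi => ?_⟩; fin_cases i <;> simp_all
  rw [hopA, chartTransform_add, h1, chartTransform_monomial, hc1,
    MohAlong.chartTransform_mul_offS (by simp [SA]) q _ _ (fun k hk i hi => ?_), h2,
    chartTransform_monomial, hc2]
  · simp only [monomial_ex, C_1]; ring
  · simp only [SA, Finset.mem_insert, Finset.mem_singleton] at hi
    rcases hi with rfl | rfl | rfl <;>
      exact apply_eq_zero_of_mem_support_X_add_one_pow 2 _ hk (by decide)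

/-- **the `x₁`-chart transform of `B_q`**: `x₁^{q−1}x₂x₃^{2q−2} + x₂(x₄+1)^{2q−2}` (`q ≥ 1`). [folklore] -/
theorem chartTransform_hopB {q : ℕ} (hq : 1 ≤ q) : chartTransform q SB 0 (hopB K q) =
    X 0 ^ (q - 1) * X 1 * X 2 ^ (2 * q - 2) + X 1 * (X 3 + 1) ^ (2 * q - 2) := by
  classical
  have h1 : (X 1 * X 2 ^ (2 * q - 2) : MvPolynomial (Fin 4) K) = monomial (ex 0 1 (2 * q - 2) 0) 1 := by
    rw [monomial_ex, C_1]; ring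
  have h2 : (X 0 ^ (q - 1) * X 1 : MvPolynomial (Fin 4) K) = monomial (ex (q - 1) 1 0 0) 1 := by
    rw [monomial_ex, C_1]; ring
  have hc1 : chartExponent q SB 0 (ex 0 1 (2 * q - 2) 0) = ex (q - 1) 1 (2 * q - 2) 0 := by
    rw [chartExponent_eq_iff, degIn_SB]
    refine ⟨by simp; omega, fun i hi => ?_⟩; fin_cases i <;> simp_all
  have hc2 : chartExponent q SB 0 (ex (q - 1) 1 0 0) = ex 0 1 0 0 := by
    rw [chartExponent_eq_iff, degIn_SB]
    refine ⟨by simp; omega, fun i hi => ?_⟩; fin_cases i <;> simp_all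
  rw [hopB, chartTransform_add, h1, chartTransform_monomial, hc1,
    MohAlong.chartTransform_mul_offS (by simp [SB]) q _ _ (fun k hk i hi => ?_), h2,
    chartTransform_monomial, hc2]
  · simp only [monomial_ex, C_1]; ring
  · simp only [SB, Finset.mem_insert, Finset.mem_singleton] at hi
    rcases hi with rfl | rfl | rfl <;>
      exact apply_eq_zero_of_mem_support_X_add_one_pow 3 _ hk (by decide)

/-- **the point transform at `bA` is `B_q`** — the hop puts `x₃ + 1 ↦ x₃` and `x₄ ↦ x₄ + 1`. [folklore] -/
theorem pointTransform_sA [DecidableEq K] {q : ℕ} (hq : 1 ≤ q) :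
    pointTransform q SA 0 bA (sA K q) = hopB K q := by
  rw [pointTransform, show (sA K q).F = hopA K q from rfl, chartTransform_hopA hq, hopB]
  simp [PointBlowup.translate, bA]
  ring

/-- **the point transform at `bB` is `A_q`.** [folklore] -/
theorem pointTransform_sB [DecidableEq K] {q : ℕ} (hq : 1 ≤ q) :
    pointTransform q SB 0 bB (sB K q) = hopA K q := by
  rw [pointTransform, show (sB K q).F = hopB K q from rfl, chartTransform_hopB hq, hopA]
  simp [PointBlowup.translate, bB]
  ring

/-- `B_q` is clean: no monomial is a `q`-th power (each carries `x₂` to the first power; `q ≥ 2`). [folklore] -/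
theorem deletePthPowers_hopB {q : ℕ} (hq : 2 ≤ q) : deletePthPowers q (hopB K q) = hopB K q := by
  classical
  refine PthPowerFactor.deletePthPowers_eq_self_of_forall q _ fun d hd hpow => ?_
  have h1 := (isPthPowerExponent_iff q d).mp hpow 1
  rw [apply_one_of_mem_support_hopB hd] at h1
  have := Nat.le_of_dvd one_pos h1
  omega

/-- `A_q` is clean. [folklore] -/
theorem deletePthPowers_hopA {q : ℕ} (hq : 2 ≤ q) : deletePthPowers q (hopA K q) = hopA K q := by
  classical
  refine PthPowerFactor.deletePthPowers_eq_self_of_forall q _ fun d hd hpow => ?_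
  have h1 := (isPthPowerExponent_iff q d).mp hpow 1
  rw [apply_one_of_mem_support_hopA hd] at h1
  have := Nat.le_of_dvd one_pos h1
  omega

/-- **THE HOP `A_q → B_q`**: `step q {x₁,x₂,x₄} x₁ (0,0,−1,1) (A_q, 0, {x₁}) = (B_q, 0, {x₁})` (`q ≥ 2`). [OURS] -/
theorem step_sA [DecidableEq K] {q : ℕ} (hq : 2 ≤ q) : CentreBlowup.step q SA 0 bA (sA K q) = sB K q := by
  have hF : deletePthPowers q (pointTransform q SA 0 bA (sA K q)) = hopB K q := by
    rw [pointTransform_sA (by omega), deletePthPowers_hopB hq]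
  have hr : newMult q SA 0 bA (sA K q) = 0 := by
    unfold newMult
    rw [show (sA K q).F = hopA K q from rfl, ordAlong_SA_hopA hq, ENat.toNat_coe, Nat.sub_self,
      show (sA K q).r = 0 from rfl]
    ext i
    rw [Finsupp.update_apply, Finsupp.filter_apply]
    split_ifs <;> simp
  have he : newExc 0 bA (sA K q) = ({0} : Finset (Fin 4)) := by
    unfold newExc; rw [show (sA K q).exc = {0} from rfl]; ext i; fin_cases i <;> simp [bA]
  unfold CentreBlowup.step
  rw [hF, hr, he]; rfl

/-- **THE HOP `B_q → A_q`**: `step q {x₁,x₂,x₃} x₁ (0,0,1,−1) (B_q, 0, {x₁}) = (A_q, 0, {x₁})` (`q ≥ 2`). [OURS] -/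
theorem step_sB [DecidableEq K] {q : ℕ} (hq : 2 ≤ q) : CentreBlowup.step q SB 0 bB (sB K q) = sA K q := by
  have hF : deletePthPowers q (pointTransform q SB 0 bB (sB K q)) = hopA K q := by
    rw [pointTransform_sB (by omega), deletePthPowers_hopA hq]
  have hr : newMult q SB 0 bB (sB K q) = 0 := by
    unfold newMult
    rw [show (sB K q).F = hopB K q from rfl, ordAlong_SB_hopB hq, ENat.toNat_coe, Nat.sub_self,
      show (sB K q).r = 0 from rfl]
    ext i
    rw [Finsupp.update_apply, Finsupp.filter_apply]
    split_ifs <;> simp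
  have he : newExc 0 bB (sB K q) = ({0} : Finset (Fin 4)) := by
    unfold newExc; rw [show (sB K q).exc = {0} from rfl]; ext i; fin_cases i <;> simp [bB]
  unfold CentreBlowup.step
  rw [hF, hr, he]; rfl

/-- the hop point at `A_q` is equimultiple (every monomial of `B_q` has degree `≥ q`). [folklore] -/
theorem isEquimultiplePoint_sA [DecidableEq K] {q : ℕ} (hq : 1 ≤ q) : IsEquimultiplePoint q SA 0 bA (sA K q) := by
  intro d _ hd
  rw [pointTransform_sA hq]
  by_contra hc
  have := le_degree_of_mem_support_hopB hq (MvPolynomial.mem_support_iff.mpr hc)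
  omega

/-- the hop point at `B_q` is equimultiple. [folklore] -/
theorem isEquimultiplePoint_sB [DecidableEq K] {q : ℕ} (hq : 1 ≤ q) : IsEquimultiplePoint q SB 0 bB (sB K q) := by
  intro d _ hd
  rw [pointTransform_sB hq]
  by_contra hc
  have := le_degree_of_mem_support_hopA hq (MvPolynomial.mem_support_iff.mpr hc)
  omega

/-- **the edge `A_q → B_q`** of the cell's global game (centre `{x₁,x₂,x₄}`). [OURS] -/
theorem edge_sA_sB [DecidableEq K] {q : ℕ} (hq : 2 ≤ q) : Edge q SA (sA K q) (sB K q) :=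
  ⟨0, bA, by simp [SA], by simp [bA], isEquimultiplePoint_sA (by omega),
    by rw [step_sA hq]; exact hopB_ne_zero hq, (step_sA hq).symm⟩

/-- **the edge `B_q → A_q`** (centre `{x₁,x₂,x₃}`). [OURS] -/
theorem edge_sB_sA [DecidableEq K] {q : ℕ} (hq : 2 ≤ q) : Edge q SB (sB K q) (sA K q) :=
  ⟨0, bB, by simp [SB], by simp [bB], isEquimultiplePoint_sB (by omega),
    by rw [step_sB hq]; exact hopA_ne_zero hq, (step_sB hq).symm⟩

/-! ## §4 Component hopping for every `q ≥ 2` -/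

/-- **THE UNIFORM BRANCH.** For every `q ≥ 2`, every field `K` and every LONE-COMPONENT rule `R` (a coordinate
rule that blows up THE component whenever the coordinate `q`-fold locus has exactly one), the sequence
`A_q, B_q, A_q, B_q, …` is an infinite `StepRule q R` branch. [OURS] -/
theorem exists_branch_of_loneComponentRule [DecidableEq K] {q : ℕ} (hq : 2 ≤ q) (R : CentreRule K)
    (hR : ∀ (s : State K) (S : Finset (Fin 4)), IsComponent q S s.F →
      (∀ S', IsComponent q S' s.F → S' = S) → R s = S) :
    ∃ c : ℕ → State K, c 0 = sA K q ∧ (∀ k, c k = sA K q ∨ c k = sB K q) ∧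
      ∀ k, StepRule q R (c k) (c (k + 1)) := by
  have hRA : R (sA K q) = SA := hR _ _ (isComponent_SA hq) fun S' hS' => (isComponent_sA_iff hq S').mp hS'
  have hRB : R (sB K q) = SB := hR _ _ (isComponent_SB hq) fun S' hS' => (isComponent_sB_iff hq S').mp hS'
  refine ⟨fun k => if k % 2 = 0 then sA K q else sB K q, by simp, fun k => ?_, fun k => ?_⟩
  · by_cases h : k % 2 = 0
    · exact Or.inl (if_pos h)
    · exact Or.inr (if_neg h)
  · by_cases h : k % 2 = 0
    · have h' : ¬ (k + 1) % 2 = 0 := by omega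
      simp only [if_pos h, if_neg h']
      rw [StepRule, hRA]
      exact ⟨(isComponent_SA hq).1, edge_sA_sB hq⟩
    · have h' : (k + 1) % 2 = 0 := by omega
      simp only [if_neg h, if_pos h']
      rw [StepRule, hRB]
      exact ⟨(isComponent_SB hq).1, edge_sB_sA hq⟩

/-- **COMPONENT HOPPING AT `(q,q)` FOR EVERY `q ≥ 2`**: over every field, no lone-component rule terminates
(`PIDim4.TerminatesUnder q`).  In particular R_OD-global — and every coordinate rule keyed to the component
structure with any tie-break — is DEAD as a UNIFORM rule at every `(p,p)`, `p` prime. [OURS] -/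
theorem not_terminatesUnder_of_loneComponentRule [DecidableEq K] {q : ℕ} (hq : 2 ≤ q) (R : CentreRule K)
    (hR : ∀ (s : State K) (S : Finset (Fin 4)), IsComponent q S s.F →
      (∀ S', IsComponent q S' s.F → S' = S) → R s = S) :
    ¬ TerminatesUnder q R := by
  intro hterm
  obtain ⟨c, -, -, hc⟩ := exists_branch_of_loneComponentRule hq R hR
  exact hterm ⟨c, hc⟩

/-- **Corollary — COMPONENT rules** (blow up SOME component whenever one exists; the class of
`LoopC.not_terminatesUnder_of_componentRule` at `(3,3)`), every `q ≥ 2`, every field. [OURS] -/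
theorem not_terminatesUnder_of_componentRule [DecidableEq K] {q : ℕ} (hq : 2 ≤ q) (R : CentreRule K)
    (hR : ∀ s : State K, (∃ S, IsComponent q S s.F) → IsComponent q (R s) s.F) :
    ¬ TerminatesUnder q R :=
  not_terminatesUnder_of_loneComponentRule hq R fun s S hS huniq => huniq (R s) (hR s ⟨S, hS⟩)

/-- **Corollary — MAXIMAL-DIMENSIONAL-component rules** (the class of `LoopC.exists_inScope_branch_of_maxDimRule`;
R_OD-global is one of them), every `q ≥ 2`, every field. [OURS] -/
theorem not_terminatesUnder_of_maxDimRule [DecidableEq K] {q : ℕ} (hq : 2 ≤ q) (R : CentreRule K)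
    (hR : ∀ s : State K,
      (∃ S, IsComponent q S s.F ∧ ∀ S', IsComponent q S' s.F → S.card ≤ S'.card) →
        IsComponent q (R s) s.F ∧ ∀ S', IsComponent q S' s.F → (R s).card ≤ S'.card) :
    ¬ TerminatesUnder q R :=
  not_terminatesUnder_of_loneComponentRule hq R fun s S hS huniq => by
    have hmax : IsComponent q S s.F ∧ ∀ S', IsComponent q S' s.F → S.card ≤ S'.card :=
      ⟨hS, fun S' hS' => (huniq S' hS').symm ▸ le_rfl⟩
    exact huniq (R s) (hR s ⟨S, hmax⟩).1

/-- The prime form: for every prime `p` and every field of characteristic `p`, no lone-component rule of the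
`(p,p)` frame terminates. [OURS] -/
theorem not_terminatesUnder_of_loneComponentRule_prime {p : ℕ} (hp : p.Prime) (L : Type) [Field L]
    [CharP L p] [DecidableEq L] (R : CentreRule L)
    (hR : ∀ (s : State L) (S : Finset (Fin 4)), IsComponent p S s.F →
      (∀ S', IsComponent p S' s.F → S' = S) → R s = S) :
    ¬ TerminatesUnder p R :=
  not_terminatesUnder_of_loneComponentRule hp.two_le R hR

end HopAllPrimes

end Summit.ResolutionOfSingularities.ResolutionOfSingularities.Theorems.PIDim4

end
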